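import Summits.CriticalPhenomena.PercolationContinuityZ3.Theorems.Transplant.FKConnectivityAllQAntipodalContract
import HarnessLib

/-!
# Connectivity correlation inequalities for `φ_{w,q}`, every `q > 0` — file 44b: **U¹¹ IN EVERY CELL** (contracted set of any size)
# of a 2-connected series–parallel graph — the gadget limit

Support file (`--supports stmt-CriticalPhenomena-4575`), FK sub-lane `prim-bschramm-fk-2` (gen 20); builds on p205010 (kernel theorem,
internal audit signed; external expert review pending).  No definitions, no named facts, no sorries; standard axioms.

**`FK.apPsiC_pivot_split_sub_nonpos_of_isTTSP`**: `E` TTSP between `s, t`, `st ∉ E`, `H = E ∪ {st}`; live set `M ⊆ H` and contracted set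
`C ⊆ H` disjoint; pivot `a ∈ M`, split pair `b ≠ c ∈ M ∖ {a}`; `0 < q ≤ 1`; `g` increasing on the subsets of `M`, reading none of `a, b, c` and no
edge of `C` ⟹ `apPsiC q M C 1_a (split_{bc}·g) ≤ 0` — i.e. EVERY coefficient `[z^{2·1_C + 1_M}] Z_H² Cov_{φ_{z,q}}(ω_a, split_{bc}·g)` is `≤ 0`.
Proof: induction on `|C|`.  `|C| = 0` is file 39.  For `C = C₀ ∪ {e}`, `e = uv`: for each `k` embed `H` into `W ⊕ Fin k` (file 41), hang `k` fresh
2-paths `u mᵢ v` (the host stays TTSP, `FK.isTTSP_gadgets`; the live set grows by the `2k` gadget edges, the contracted set is `C₀`): the induction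
hypothesis gives `D_k ≤ 0` there, the gadget iteration (`FK.gadget_iterate`, files 42a/42b) and the transport (`FK.apPsiC_map`) turn this into
`2^k D + ((2+q)^k − 2^k) L + ((2+2q)^k − 2(2+q)^k + 2^k) K ≤ 0` with `D, L ≤ 0` cells of `C₀` (induction hypothesis on `W`) and `K` the target;
`FK.gadget_limit` concludes.  Consequences (file 45): `maj₃`, the four-edge thresholds and level ≤ 3 in EVERY coefficient, and the value-level
statements under `φ_{w,q}`.  Memo `bschramm/FROM-fk-2-g20-LEVEL3-ONESUM.md` §6.2.
[cite: Grimmett2006, §1.4 eq. (1.20) (p. 15); §3.8 Thm. (3.90) (pp. 61–62); §3.9 (pp. 63–64)] [cite: Wagner2006, Thm. 5.8(d), §5.3]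
-/

noncomputable section

namespace Summit.CriticalPhenomena.PercolationContinuityZ3.Theorems

namespace FK

open Literature.Probability.LatticeModels Literature.Probability.Percolation
open scoped Classical

universe u

/-! ### Small helpers -/

section Helpers

variable {W : Type*}

/-- With no contracted edge the minor form is the antipodal form. [folklore] -/
theorem apPsiC_empty (q : ℝ) (M : Finset (Sym2 W)) (f g : Finset (Sym2 W) → ℝ) : apPsiC q M ∅ f g = apPsi q M f g := by
  unfold apPsiC apPsi apExpC apExp
  simp only [Finset.union_empty]

/-- A function monotone on the subsets of `M` and not reading `e` is monotone on the subsets of `M ∪ {e}`. [folklore] -/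
theorem mono_insert_of_notRead {M : Finset (Sym2 W)} {e : Sym2 W} {g : Finset (Sym2 W) → ℝ}
    (hge : ∀ A : Finset (Sym2 W), g (insert e A) = g A) (hmono : ∀ ⦃A B : Finset (Sym2 W)⦄, A ⊆ B → B ⊆ M → g A ≤ g B)
    ⦃A B : Finset (Sym2 W)⦄ (hAB : A ⊆ B) (hB : B ⊆ insert e M) : g A ≤ g B := by
  have hA' : g A = g (A.erase e) := by
    by_cases h : e ∈ A
    · conv_lhs => rw [← Finset.insert_erase h]
      exact hge _
    · rw [Finset.erase_eq_of_notMem h]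
  have hB' : g B = g (B.erase e) := by
    by_cases h : e ∈ B
    · conv_lhs => rw [← Finset.insert_erase h]
      exact hge _
    · rw [Finset.erase_eq_of_notMem h]
  rw [hA', hB']
  exact hmono (Finset.erase_subset_erase _ hAB) (fun x hx => by
    have hx' := Finset.mem_erase.1 hx
    rcases Finset.mem_insert.1 (hB hx'.2) with h | h
    · exact absurd h hx'.1
    · exact h)

variable {k : ℕ}

/-- Image pairs avoid the fresh vertices. [folklore] -/
theorem inr_notMem_of_mem_map (X : Finset (Sym2 W)) {e' : Sym2 (W ⊕ Fin k)}
    (he' : e' ∈ X.map (Function.Embedding.inl (β := Fin k)).sym2Map) (i : Fin k) : (Sum.inr i : W ⊕ Fin k) ∉ e' := by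
  rw [Finset.mem_map] at he'
  obtain ⟨e, _, rfl⟩ := he'
  intro h
  obtain ⟨w, _, hw⟩ := (mem_sym2Map_iff _).1 h
  exact Sum.inl_ne_inr hw

/-- Gadget pairs are off the range of the embedding of pairs. [folklore] -/
theorem gadget_notMem_range {u' v' : W ⊕ Fin k} {S : Finset (W ⊕ Fin k)} (hS : ∀ m ∈ S, ∃ i : Fin k, m = Sum.inr i)
    {e' : Sym2 (W ⊕ Fin k)} (he' : e' ∈ S.biUnion fun m => ({s(u', m)} ∪ {s(m, v')} : Finset (Sym2 (W ⊕ Fin k)))) :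
    e' ∉ Set.range (Function.Embedding.inl (α := W) (β := Fin k)).sym2Map := by
  rw [Finset.mem_biUnion] at he'
  obtain ⟨m, hm, he'⟩ := he'
  obtain ⟨i, rfl⟩ := hS m hm
  simp only [Finset.mem_union, Finset.mem_singleton] at he'
  have hmem : (Sum.inr i : W ⊕ Fin k) ∈ e' := by
    rcases he' with rfl | rfl
    · exact Sym2.mem_mk_right _ _
    · exact Sym2.mem_mk_left _ _
  exact notMem_range_sym2Map_of_mem _ (fun ⟨w, hw⟩ => Sum.inl_ne_inr hw) hmem

end Helpers

/-! ### The induction on the size of the contracted set -/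

/-- The induction statement: pivot at the root, contracted set of size `n`, arbitrary vertex type in universe `u`. [folklore] -/
theorem apPsiC_pivot_split_root_nonpos_aux (n : ℕ) :
    ∀ {W : Type u} [Fintype W] {q : ℝ}, 0 < q → q ≤ 1 → ∀ {E : Finset (Sym2 W)} {a₁ a₂ : W}, IsTTSP E a₁ a₂ → s(a₁, a₂) ∉ E →
      ∀ {M C : Finset (Sym2 W)}, M ⊆ insert s(a₁, a₂) E → C ⊆ insert s(a₁, a₂) E → Disjoint M C → s(a₁, a₂) ∈ M →
      ∀ {b c : Sym2 W}, b ∈ M → c ∈ M → s(a₁, a₂) ≠ b → s(a₁, a₂) ≠ c → b ≠ c →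
      ∀ {g : Finset (Sym2 W) → ℝ}, (∀ A, g (insert s(a₁, a₂) A) = g A) → (∀ A, g (insert b A) = g A) → (∀ A, g (insert c A) = g A) →
        (∀ e ∈ C, ∀ A, g (insert e A) = g A) → (∀ ⦃A B : Finset (Sym2 W)⦄, A ⊆ B → B ⊆ M → g A ≤ g B) → C.card = n →
        apPsiC q M C (fun A => if s(a₁, a₂) ∈ A then 1 else 0) (fun A => splitInd b c A * g A) ≤ 0 := by
  induction n with
  | zero =>
    intro W _ q hq0 hq1 E a₁ a₂ hE hx M C hM hC hMC hxM b c hb hc hxb hxc hbc g hgx hgb hgc hgC hmono hcard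
    rw [Finset.card_eq_zero.1 hcard, apPsiC_empty]
    exact apPsi_pivot_split_sub_nonpos_of_isTTSP hq0 hq1 hE hx hM hxM hb hc hxb hxc hbc hgx hgb hgc hmono
  | succ n ih =>
    intro W _ q hq0 hq1 E a₁ a₂ hE hx M C hM hC hMC hxM b c hb hc hxb hxc hbc g hgx hgb hgc hgC hmono hcard
    set x := s(a₁, a₂) with hxdef
    -- pick a contracted edge e = uv
    obtain ⟨e, he⟩ : C.Nonempty := Finset.card_pos.1 (by omega)
    have heM : e ∉ M := fun h => Finset.disjoint_left.1 hMC h he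
    have hex : e ≠ x := fun h => heM (h ▸ hxM)
    have heE : e ∈ E := by
      rcases Finset.mem_insert.1 (hC he) with h | h
      · exact absurd h hex
      · exact h
    have hge : ∀ A : Finset (Sym2 W), g (insert e A) = g A := hgC e he
    set C₀ := C.erase e with hC₀def
    have hC₀card : C₀.card = n := by rw [Finset.card_erase_of_mem he]; omega
    have hCeq : insert e C₀ = C := Finset.insert_erase he
    have heC₀ : e ∉ C₀ := Finset.notMem_erase _ _
    have hC₀ : C₀ ⊆ insert x E := (Finset.erase_subset _ _).trans hC
    have hMC₀ : Disjoint M C₀ := Finset.disjoint_of_subset_right (Finset.erase_subset _ _) hMC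
    have hgC₀ : ∀ e' ∈ C₀, ∀ A : Finset (Sym2 W), g (insert e' A) = g A := fun e' he' => hgC e' (Finset.mem_of_mem_erase he')
    -- the two cells of C₀ on W
    have hD : apPsiC q M C₀ (fun A => if x ∈ A then 1 else 0) (fun A => splitInd b c A * g A) ≤ 0 :=
      ih hq0 hq1 hE hx hM hC₀ hMC₀ hxM hb hc hxb hxc hbc hgx hgb hgc hgC₀ hmono hC₀card
    have hL : apPsiC q (insert e M) C₀ (fun A => if x ∈ A then 1 else 0) (fun A => splitInd b c A * g A) ≤ 0 :=
      ih hq0 hq1 hE hx (Finset.insert_subset (hC he) hM) hC₀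
        (Finset.disjoint_insert_left.2 ⟨heC₀, hMC₀⟩) (Finset.mem_insert_of_mem hxM)
        (Finset.mem_insert_of_mem hb) (Finset.mem_insert_of_mem hc) hxb hxc hbc hgx hgb hgc hgC₀
        (fun A B hAB hB => mono_insert_of_notRead hge hmono hAB hB) hC₀card
    -- endpoints of e
    induction e using Sym2.ind with
    | h u v =>
    have huv : u ≠ v := fun h => hE.not_isDiag heE (Sym2.mk_isDiag_iff.2 h)
    refine gadget_limit hq0 hD hL fun k => ?_
    -- one decidability instance for the pairs over `W ⊕ Fin k` (the classical one used by the generic lemmas)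
    letI instDecW : DecidableEq (W ⊕ Fin k) := fun a b => Classical.propDecidable (a = b)
    -- the k-th gadget host on W ⊕ Fin k
    obtain ⟨j, hj⟩ : ∃ j : W ↪ W ⊕ Fin k, j = Function.Embedding.inl := ⟨_, rfl⟩
    have hjw : ∀ w : W, j w = Sum.inl w := fun w => by rw [hj]; rfl
    obtain ⟨S, hSdef⟩ : ∃ S : Finset (W ⊕ Fin k), S = Finset.univ.map ⟨Sum.inr, Sum.inr_injective⟩ := ⟨_, rfl⟩
    have hS : ∀ m ∈ S, ∃ i : Fin k, m = Sum.inr i := by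
      intro m hm
      rw [hSdef, Finset.mem_map] at hm
      obtain ⟨i, _, rfl⟩ := hm
      exact ⟨i, rfl⟩
    have hScard : S.card = k := by rw [hSdef, Finset.card_map, Finset.card_univ, Fintype.card_fin]
    have hSu : j u ∉ S := fun h => by obtain ⟨i, hi⟩ := hS _ h; rw [hjw] at hi; exact Sum.inl_ne_inr hi
    have hSv : j v ∉ S := fun h => by obtain ⟨i, hi⟩ := hS _ h; rw [hjw] at hi; exact Sum.inl_ne_inr hi
    have hrange : ∀ i : Fin k, (Sum.inr i : W ⊕ Fin k) ∉ Set.range j := fun i ⟨w, hw⟩ => by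
      rw [hjw] at hw; exact Sum.inl_ne_inr hw
    have freshX : ∀ (X : Finset (Sym2 W)), ∀ m ∈ S, ∀ e' ∈ X.map j.sym2Map, m ∉ e' := by
      intro X m hm e' he' hme
      obtain ⟨i, rfl⟩ := hS m hm
      rw [Finset.mem_map] at he'
      obtain ⟨e₀, _, rfl⟩ := he'
      obtain ⟨w, _, hw⟩ := (mem_sym2Map_iff j).1 hme
      exact hrange i ⟨w, hw⟩
    have hGoff : ∀ e' ∈ S.biUnion (fun m => ({s(j u, m)} ∪ {s(m, j v)} : Finset (Sym2 (W ⊕ Fin k)))),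
        e' ∉ Set.range j.sym2Map := by
      intro e' he'
      rw [Finset.mem_biUnion] at he'
      obtain ⟨m, hm, he'⟩ := he'
      obtain ⟨i, rfl⟩ := hS m hm
      simp only [Finset.mem_union, Finset.mem_singleton] at he'
      have hmem : (Sum.inr i : W ⊕ Fin k) ∈ e' := by
        rcases he' with rfl | rfl
        · exact Sym2.mem_mk_right _ _
        · exact Sym2.mem_mk_left _ _
      exact notMem_range_sym2Map_of_mem j (hrange i) hmem
    -- transported data
    have hjx : j.sym2Map x = s(j a₁, j a₂) := by rw [hxdef, Function.Embedding.sym2Map_apply, Sym2.map_mk]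
    have hje : j.sym2Map s(u, v) = s(j u, j v) := by rw [Function.Embedding.sym2Map_apply, Sym2.map_mk]
    have hinj := j.sym2Map.injective
    have heE' : s(j u, j v) ∈ E.map j.sym2Map := by rw [← hje]; exact Finset.mem_map_of_mem _ heE
    have hE' := isTTSP_gadgets (hE.map j) heE' S hSu hSv (freshX E)
    have hxE' : s(j a₁, j a₂) ∉ E.map j.sym2Map ∪ S.biUnion fun m => {s(j u, m)} ∪ {s(m, j v)} := by
      rw [← hjx]
      intro h
      rcases Finset.mem_union.1 h with h | h
      · exact hx ((Finset.mem_map' _).1 h)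
      · exact hGoff _ h ⟨x, rfl⟩
    have hsubH : ∀ X : Finset (Sym2 W), X ⊆ insert x E →
        X.map j.sym2Map ⊆ insert s(j a₁, j a₂) (E.map j.sym2Map ∪ S.biUnion fun m => {s(j u, m)} ∪ {s(m, j v)}) := by
      intro X hX y hy
      rw [Finset.mem_map] at hy
      obtain ⟨y₀, hy₀, rfl⟩ := hy
      rcases Finset.mem_insert.1 (hX hy₀) with h | h
      · rw [h, hjx]; exact Finset.mem_insert_self _ _
      · exact Finset.mem_insert_of_mem (Finset.mem_union_left _ (Finset.mem_map_of_mem _ h))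
    have hM' : (M.map j.sym2Map ∪ S.biUnion fun m => {s(j u, m)} ∪ {s(m, j v)}) ⊆
        insert s(j a₁, j a₂) (E.map j.sym2Map ∪ S.biUnion fun m => {s(j u, m)} ∪ {s(m, j v)}) :=
      Finset.union_subset (hsubH M hM) (Finset.subset_union_right.trans (Finset.subset_insert _ _))
    have hC' : C₀.map j.sym2Map ⊆ insert s(j a₁, j a₂) (E.map j.sym2Map ∪ S.biUnion fun m => {s(j u, m)} ∪ {s(m, j v)}) :=
      hsubH C₀ hC₀
    have hM'C' : Disjoint (M.map j.sym2Map ∪ S.biUnion fun m => {s(j u, m)} ∪ {s(m, j v)}) (C₀.map j.sym2Map) := by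
      rw [Finset.disjoint_union_left]
      refine ⟨(Finset.disjoint_map _).2 hMC₀, Finset.disjoint_left.2 fun e' he' he'C => hGoff e' he' ?_⟩
      rw [Finset.mem_map] at he'C
      obtain ⟨e₀, _, rfl⟩ := he'C
      exact ⟨e₀, rfl⟩
    have hx'M : s(j a₁, j a₂) ∈ (M.map j.sym2Map ∪ S.biUnion fun m => {s(j u, m)} ∪ {s(m, j v)}) := by
      rw [← hjx]; exact Finset.mem_union_left _ (Finset.mem_map_of_mem _ hxM)
    have hb'M : j.sym2Map b ∈ (M.map j.sym2Map ∪ S.biUnion fun m => {s(j u, m)} ∪ {s(m, j v)}) :=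
      Finset.mem_union_left _ (Finset.mem_map_of_mem _ hb)
    have hc'M : j.sym2Map c ∈ (M.map j.sym2Map ∪ S.biUnion fun m => {s(j u, m)} ∪ {s(m, j v)}) :=
      Finset.mem_union_left _ (Finset.mem_map_of_mem _ hc)
    have hx'b : s(j a₁, j a₂) ≠ j.sym2Map b := by rw [← hjx]; exact fun h => hxb (hinj h)
    have hx'c : s(j a₁, j a₂) ≠ j.sym2Map c := by rw [← hjx]; exact fun h => hxc (hinj h)
    have hb'c : j.sym2Map b ≠ j.sym2Map c := fun h => hbc (hinj h)
    -- the transported test function (pull-back along j; proved here by extensionality to keep one decidability instance)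
    obtain ⟨g', g'map, g'read, g'off, g'mono⟩ : ∃ g' : Finset (Sym2 (W ⊕ Fin k)) → ℝ,
        (∀ X : Finset (Sym2 W), g' (X.map j.sym2Map) = g X) ∧
        (∀ y : Sym2 W, (∀ A : Finset (Sym2 W), g (insert y A) = g A) →
          ∀ A' : Finset (Sym2 (W ⊕ Fin k)), g' (insert (j.sym2Map y) A') = g' A') ∧
        (∀ e' : Sym2 (W ⊕ Fin k), e' ∉ Set.range j.sym2Map → ∀ A' : Finset (Sym2 (W ⊕ Fin k)), g' (insert e' A') = g' A') ∧
        (∀ ⦃A' B' : Finset (Sym2 (W ⊕ Fin k))⦄, A' ⊆ B' →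
          B' ⊆ (M.map j.sym2Map ∪ S.biUnion fun m => {s(j u, m)} ∪ {s(m, j v)}) → g' A' ≤ g' B') := by
      refine ⟨fun X' => g (Finset.univ.filter fun e₀ : Sym2 W => j.sym2Map e₀ ∈ X'), fun X => ?_, fun y hy A' => ?_,
        fun e' he' A' => ?_, fun A' B' hAB hB => ?_⟩
      · show g _ = g _
        congr 1
        ext e₀
        simp only [Finset.mem_filter, Finset.mem_univ, true_and, Finset.mem_map']
      · show g _ = g _
        have hset : (Finset.univ.filter fun e₀ : Sym2 W => j.sym2Map e₀ ∈ insert (j.sym2Map y) A') =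
            insert y (Finset.univ.filter fun e₀ : Sym2 W => j.sym2Map e₀ ∈ A') := by
          ext e₀
          simp only [Finset.mem_filter, Finset.mem_univ, true_and, Finset.mem_insert, hinj.eq_iff]
        rw [hset, hy]
      · show g _ = g _
        congr 1
        ext e₀
        simp only [Finset.mem_filter, Finset.mem_univ, true_and, Finset.mem_insert]
        constructor
        · rintro (h | h)
          · exact absurd ⟨e₀, h⟩ he'
          · exact h
        · exact fun h => Or.inr h
      · show g _ ≤ g _
        refine hmono (fun e₀ he₀ => ?_) (fun e₀ he₀ => ?_)
        · simp only [Finset.mem_filter, Finset.mem_univ, true_and] at he₀ ⊢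
          exact hAB he₀
        · simp only [Finset.mem_filter, Finset.mem_univ, true_and] at he₀
          rcases Finset.mem_union.1 (hB he₀) with h | h
          · exact (Finset.mem_map' _).1 h
          · exact absurd ⟨e₀, rfl⟩ (hGoff _ h)
    -- the induction hypothesis on W ⊕ Fin k: D_k ≤ 0
    have hDk : apPsiC q (M.map j.sym2Map ∪ S.biUnion fun m => {s(j u, m)} ∪ {s(m, j v)}) (C₀.map j.sym2Map)
        (fun A => if s(j a₁, j a₂) ∈ A then 1 else 0) (fun A => splitInd (j.sym2Map b) (j.sym2Map c) A * g' A) ≤ 0 :=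
      ih hq0 hq1 hE' hxE' hM' hC' hM'C' hx'M hb'M hc'M hx'b hx'c hb'c (g := g')
        (by rw [← hjx]; exact g'read x hgx) (g'read b hgb) (g'read c hgc)
        (fun e' he' => by
          rw [Finset.mem_map] at he'
          obtain ⟨e₀, he₀, rfl⟩ := he'
          exact g'read e₀ (hgC₀ e₀ he₀)) g'mono
        (by rw [Finset.card_map, hC₀card])
    -- the gadget iteration on W ⊕ Fin k
    have fS : ∀ m ∈ S, ∀ w : W ⊕ Fin k, ∀ A : Finset (Sym2 (W ⊕ Fin k)),
        (fun A : Finset (Sym2 (W ⊕ Fin k)) => if s(j a₁, j a₂) ∈ A then (1 : ℝ) else 0) (insert s(m, w) A) =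
          (fun A : Finset (Sym2 (W ⊕ Fin k)) => if s(j a₁, j a₂) ∈ A then (1 : ℝ) else 0) A := by
      intro m hm w A
      obtain ⟨i, rfl⟩ := hS m hm
      have hne : s(j a₁, j a₂) ≠ s(Sum.inr i, w) := fun h => by
        have hmem : (Sum.inr i : W ⊕ Fin k) ∈ s(j a₁, j a₂) := h ▸ Sym2.mem_mk_left _ _
        rcases Sym2.mem_iff.1 hmem with h1 | h1
        · exact hrange i ⟨a₁, h1.symm⟩
        · exact hrange i ⟨a₂, h1.symm⟩
      simp only [Finset.mem_insert, hne, false_or]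
    have off_mw : ∀ m ∈ S, ∀ w : W ⊕ Fin k, s(m, w) ∉ Set.range j.sym2Map := by
      intro m hm w
      obtain ⟨i, rfl⟩ := hS m hm
      exact notMem_range_sym2Map_of_mem j (hrange i) (Sym2.mem_mk_left _ _)
    have gS : ∀ m ∈ S, ∀ w : W ⊕ Fin k, ∀ A : Finset (Sym2 (W ⊕ Fin k)),
        (fun A => splitInd (j.sym2Map b) (j.sym2Map c) A * g' A) (insert s(m, w) A) =
          (fun A => splitInd (j.sym2Map b) (j.sym2Map c) A * g' A) A := by
      intro m hm w A
      have hoff := off_mw m hm w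
      have hb' : s(m, w) ≠ j.sym2Map b := fun h => hoff ⟨b, h.symm⟩
      have hc' : s(m, w) ≠ j.sym2Map c := fun h => hoff ⟨c, h.symm⟩
      simp only [splitInd_insert_of_ne hb' hc', g'off _ hoff]
    have fe : ∀ A : Finset (Sym2 (W ⊕ Fin k)),
        (fun A : Finset (Sym2 (W ⊕ Fin k)) => if s(j a₁, j a₂) ∈ A then (1 : ℝ) else 0) (insert s(j u, j v) A) =
          (fun A : Finset (Sym2 (W ⊕ Fin k)) => if s(j a₁, j a₂) ∈ A then (1 : ℝ) else 0) A := by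
      intro A
      have hne : s(j a₁, j a₂) ≠ s(j u, j v) := by rw [← hjx, ← hje]; exact fun h => hex (hinj h).symm
      simp only [Finset.mem_insert, hne, false_or]
    have ge : ∀ A : Finset (Sym2 (W ⊕ Fin k)),
        (fun A => splitInd (j.sym2Map b) (j.sym2Map c) A * g' A) (insert s(j u, j v) A) =
          (fun A => splitInd (j.sym2Map b) (j.sym2Map c) A * g' A) A := by
      intro A
      have heb : s(u, v) ≠ b := fun h => heM (h ▸ hb)
      have hec : s(u, v) ≠ c := fun h => heM (h ▸ hc)
      have hb' : s(j u, j v) ≠ j.sym2Map b := by rw [← hje]; exact fun h => heb (hinj h)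
      have hc' : s(j u, j v) ≠ j.sym2Map c := by rw [← hje]; exact fun h => hec (hinj h)
      simp only [splitInd_insert_of_ne hb' hc']
      rw [← hje, g'read _ hge]
    have heM' : s(j u, j v) ∉ M.map j.sym2Map := by
      rw [← hje]; exact fun h => heM ((Finset.mem_map' _).1 h)
    have hjuv : j u ≠ j v := fun h => huv (j.injective h)
    obtain ⟨iter, -, -⟩ := gadget_iterate (q := q) (C := C₀.map j.sym2Map)
      (f := fun A : Finset (Sym2 (W ⊕ Fin k)) => if s(j a₁, j a₂) ∈ A then (1 : ℝ) else 0)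
      (g := fun A => splitInd (j.sym2Map b) (j.sym2Map c) A * g' A) hjuv heM' fe ge S hSu hSv (freshX M)
      (freshX C₀) fS gS
    rw [hScard] at iter
    -- transport of the three W-cells along j
    have tf : ∀ X : Finset (Sym2 W),
        (fun A : Finset (Sym2 (W ⊕ Fin k)) => if s(j a₁, j a₂) ∈ A then (1 : ℝ) else 0) (X.map j.sym2Map) =
          (fun A : Finset (Sym2 W) => if x ∈ A then (1 : ℝ) else 0) X := by
      intro X; simp only [← hjx, Finset.mem_map' ]
    have tg : ∀ X : Finset (Sym2 W),
        (fun A => splitInd (j.sym2Map b) (j.sym2Map c) A * g' A) (X.map j.sym2Map) =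
          (fun A => splitInd b c A * g A) X := by
      intro X
      simp only [g'map]
      unfold splitInd
      simp only [Finset.mem_map' ]
    have tD := apPsiC_map j q M C₀ (f := fun A : Finset (Sym2 W) => if x ∈ A then (1 : ℝ) else 0)
      (g := fun A => splitInd b c A * g A) (f' := fun A : Finset (Sym2 (W ⊕ Fin k)) => if s(j a₁, j a₂) ∈ A then (1 : ℝ) else 0)
      (g' := fun A => splitInd (j.sym2Map b) (j.sym2Map c) A * g' A) tf tg
    have tL := apPsiC_map j q (insert s(u, v) M) C₀ (f := fun A : Finset (Sym2 W) => if x ∈ A then (1 : ℝ) else 0)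
      (g := fun A => splitInd b c A * g A) (f' := fun A : Finset (Sym2 (W ⊕ Fin k)) => if s(j a₁, j a₂) ∈ A then (1 : ℝ) else 0)
      (g' := fun A => splitInd (j.sym2Map b) (j.sym2Map c) A * g' A) tf tg
    have tK := apPsiC_map j q M C (f := fun A : Finset (Sym2 W) => if x ∈ A then (1 : ℝ) else 0)
      (g := fun A => splitInd b c A * g A) (f' := fun A : Finset (Sym2 (W ⊕ Fin k)) => if s(j a₁, j a₂) ∈ A then (1 : ℝ) else 0)
      (g' := fun A => splitInd (j.sym2Map b) (j.sym2Map c) A * g' A) tf tg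
    rw [Finset.map_insert, hje] at tL
    rw [← hCeq, Finset.map_insert, hje] at tK
    rw [tD, tL, tK] at iter
    -- conclude for this k
    have hpos : 0 < q ^ (2 * k) := pow_pos hq0 _
    have hpos' : 0 < q ^ (2 * Nat.card {y : W ⊕ Fin k // y ∉ Set.range j}) := pow_pos hq0 _
    have key := mul_nonpos_of_nonneg_of_nonpos hpos.le hDk
    rw [iter, hCeq] at key
    nlinarith [key, hpos']

/-- **U¹¹ IN EVERY CELL** (`0 < q ≤ 1`).  `E` two-terminal series–parallel between `s, t`, `st ∉ E`, `H = E ∪ {st}`; live set `M ⊆ H`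
and contracted set `C ⊆ H` disjoint; pivot `a ∈ M`, split pair `b ≠ c ∈ M ∖ {a}`; `g` increasing on the subsets of `M`, reading none of
`a, b, c` and no edge of `C` ⟹ `apPsiC q M C 1_a (split_{bc}·g) ≤ 0`: EVERY coefficient `[z^{2·1_C + 1_M}] Z_H² Cov_{φ_{z,q}}(ω_a, split_{bc}·g)` of a
2-connected series–parallel graph is `≤ 0` (re-root at `a`, then `FK.apPsiC_pivot_split_root_nonpos_aux`).  With file 32c's AND theorem and gen 11's
Theorem U in every cell this makes gen 10's Conjecture `C_∞` hold at levels ≤ 3 (and for the four-edge thresholds) in EVERY coefficient.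
[cite: Grimmett2006, §1.4 eq. (1.20) (p. 15); §3.8 Thm. (3.90) (pp. 61–62); §3.9 (pp. 63–64)] [cite: Wagner2006, Thm. 5.8(d), §5.3] -/
theorem apPsiC_pivot_split_sub_nonpos_of_isTTSP {V : Type u} [Fintype V] {q : ℝ} (hq0 : 0 < q) (hq1 : q ≤ 1)
    {E : Finset (Sym2 V)} {s t : V} (hE : IsTTSP E s t) (hst : s(s, t) ∉ E)
    {M C : Finset (Sym2 V)} (hM : M ⊆ insert s(s, t) E) (hC : C ⊆ insert s(s, t) E) (hMC : Disjoint M C)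
    {a b c : Sym2 V} (ha : a ∈ M) (hb : b ∈ M) (hc : c ∈ M) (hab : a ≠ b) (hac : a ≠ c) (hbc : b ≠ c)
    {g : Finset (Sym2 V) → ℝ} (hga : ∀ A : Finset (Sym2 V), g (insert a A) = g A)
    (hgb : ∀ A : Finset (Sym2 V), g (insert b A) = g A) (hgc : ∀ A : Finset (Sym2 V), g (insert c A) = g A)
    (hgC : ∀ e ∈ C, ∀ A : Finset (Sym2 V), g (insert e A) = g A)
    (hmono : ∀ ⦃A B : Finset (Sym2 V)⦄, A ⊆ B → B ⊆ M → g A ≤ g B) :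
    apPsiC q M C (fun A => if a ∈ A then 1 else 0) (fun A => splitInd b c A * g A) ≤ 0 := by
  induction a using Sym2.ind with
  | h a₁ a₂ =>
    have hR := hE.reroot_erase (hM ha) (insert_ne_singleton_of_isTTSP hE hst _)
    have hH : insert s(a₁, a₂) ((insert s(s, t) E).erase s(a₁, a₂)) = insert s(s, t) E := Finset.insert_erase (hM ha)
    exact apPsiC_pivot_split_root_nonpos_aux C.card hq0 hq1 hR (Finset.notMem_erase _ _) (by rw [hH]; exact hM)
      (by rw [hH]; exact hC) hMC ha hb hc hab hac hbc hga hgb hgc hgC hmono rfl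

end FK

end Summit.CriticalPhenomena.PercolationContinuityZ3.Theorems

end
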